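import Literature.NumberTheory.Automorphic.Liu2021.AppendixC.HeckeTranslates
import HarnessLib

/-!
# The honest Hecke correspondence on difference points: `𝒯(α_K(∇u z)) = ∏_{δ, α} α_K(∇(T_{g_α} ∘ δ) z)` (Liu 2021, §4.2 / App. D)

Topic `Literature/NumberTheory/Automorphic/Liu2021/AppendixC`; namespace
`Literature.NumberTheory.Automorphic.Liu2021.AppendixC.Sec42Data.HeckeTranslates`.  PROOF FILE (theorems only; no definition, no named
fact, no instance, no `sorry`).  Cell `hodgecm-mathlib` (D-0151), FLOOR-0 P5a, pole of the D9op road 2′ (sub-line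
`Cruxes/HLiu418/Lines/F0_D9opRoad2.lean`, letter `RecordCurveEichlerShimuraHonest` / pointwise `stub_C`), piece **C1** of the census
`F0/P5a/L3a-POLE-census.v0.1.F0P5a-p02g0.md` §2 («the honest correspondence as a cycle, char 0, generic over `Sec42Data`»).

SETTING ([Liu2021] §4.2, l. 2060–2074; Def. 2.1 (1), Def. 2.3): a §4.2 datum `C` (tower `K ↦ X_K` with Albanese data
`α_K : ∇X_K → A_K`, transition morphisms `u = C.cpt.X.map f`, `∇u = C.nablaTr f`, `Alb_u = C.Atr f`) with Hecke translates `T`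
(`T_g : X_N → X_K`, `Alb(T_g) = T.albTr g N K`).  The HONEST Hecke correspondence of the D9op letter is the endomorphism
`𝒯 := t ≫ ∑_α Alb(T_{g_α})` of `A_K`, where `t : A_K → A_N` is the Albanese TRACE of the Galois covering `u : X_N → X_K` with group
`Δ`, characterised by `Alb_u ≫ t = ∑_{δ ∈ Δ} Alb(δ)` (★ `albaneseTraceOfFiniteQuotient_holds`, [Lang1983AbelianVarieties] VIII §6 Thm. 13).

RESULT (`nablaTr_comp_α_comp_trace_sum_albTr`, with its `W`-point form `comp_nablaTr_comp_α_comp_trace_sum_albTr`): in the commutative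
group `Hom(∇X_N, A_K)` of `∇X_N`-valued points of `A_K`,

  `∇u ≫ α_K ≫ (t ≫ ∑_{i ∈ s} Alb(T_{g_i})) = ∏_δ ∏_{i ∈ s} ∇(act δ) ≫ ∇(T_{g_i}) ≫ α_K`,

i.e. on a difference point `α_K(u x̃, u ỹ)` the honest correspondence takes the value `∑_{δ, i} α_K(T_{g_i} δ x̃, T_{g_i} δ ỹ)` —
Lang's/Milne's «a Hecke correspondence is the sum of its translates» ([Milne2005ShimuraVarieties] §5 p. 58) read on the Albanese
through the trace.  Pure category algebra over the printed identities `Alb_u ∘ α_N = α_K ∘ ∇u` (★ `Sec42Data.α_Atr`),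
`Alb(T_g) ∘ α_N = α_K ∘ ∇T_g` (★ `HeckeTranslates.α_albTr`), `Alb_v ∘ α = α ∘ ∇v` (★ `Albanese.α_map`), bilinearity of composition
(Mathlib `Preadditive`), and «a point followed by a sum of homomorphisms is the product of the composites».  No field hypothesis.

HC_CM is proved only modulo the 7 printed citations until rung 0 closes; nothing of [Liu2021] is asserted here.

## References
* [Liu2021] Y. Liu, *Fourier–Jacobi cycles and arithmetic relative trace formula*, Camb. J. Math. 9 (2021) = arXiv:2102.11518: Def. 2.1 (1)
  (FJcycle.tex l. 1171–1176), Def. 2.3 (l. 1202–1208), §4.2 (l. 2060–2074), App. D proof of Cor. D.9 (p. 139).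
* [Lang1983AbelianVarieties] S. Lang, *Abelian Varieties* (1959/1983), Ch. VIII §6 Thm. 13 (pp. 224–227).
* [Milne2005ShimuraVarieties] J. S. Milne, *Introduction to Shimura varieties* (2005/2017), §5 p. 58, §13 p. 118.
-/

set_option autoImplicit false

noncomputable section

open CategoryTheory AlgebraicGeometry NumberField
open Literature.AlgebraicGeometry.Motives (SchemeOver AbelianVariety)

namespace Literature.NumberTheory.Automorphic.Liu2021.AppendixC

open scoped MonObj

/-! ### Points followed by sums / products of homomorphisms (bookkeeping in the hom-group of a commutative group scheme) -/

section Points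

variable {k : Type} [Field k]

/-- The sum of two homomorphisms of abelian varieties is, on underlying group-scheme maps, the product in Mathlib's `Hom.commGroup`
(by construction of the additive structure; twin of ★ `AbelianVariety.hom_hom_hom_add`). [folklore] -/
private theorem hom_hom_hom_add' {B B' : AbelianVariety k} (f g : B ⟶ B') :
    (f + g).hom.hom.hom = f.hom.hom.hom * g.hom.hom.hom := rfl

/-- A point followed by a finite SUM of homomorphisms of abelian varieties is the PRODUCT of the composites (the addition of
`Hom(B, B')` is the pointwise product; Mathlib `MonObj.comp_mul`). [folklore] -/
private theorem comp_finsetSum_hom_hom_hom {T : SchemeOver k} {B B' : AbelianVariety k} (x : T ⟶ B.X) {I : Type} (s : Finset I)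
    (f : I → (B ⟶ B')) : x ≫ (∑ i ∈ s, f i).hom.hom.hom = ∏ i ∈ s, x ≫ (f i).hom.hom.hom := by
  classical
  induction s using Finset.induction_on with
  | empty =>
    rw [Finset.sum_empty, Finset.prod_empty]
    exact MonObj.comp_one x
  | insert a s ha ih =>
    rw [Finset.sum_insert ha, Finset.prod_insert ha, hom_hom_hom_add', MonObj.comp_mul, ih]

/-- A morphism followed by a finite PRODUCT in the hom-group of a group scheme is the product of the composites
(Mathlib `MonObj.comp_mul`, `MonObj.comp_one`). [folklore] -/
private theorem comp_finsetProd {T W : SchemeOver k} {G : SchemeOver k} [GrpObj G] [IsCommMonObj G] (z : T ⟶ W) {I : Type} (s : Finset I)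
    (f : I → (W ⟶ G)) : z ≫ (∏ i ∈ s, f i) = ∏ i ∈ s, z ≫ f i := by
  classical
  induction s using Finset.induction_on with
  | empty =>
    rw [Finset.prod_empty, Finset.prod_empty]
    exact MonObj.comp_one z
  | insert a s ha ih =>
    rw [Finset.prod_insert ha, Finset.prod_insert ha, MonObj.comp_mul, ih]

end Points

variable {F E : Type} [Field F] [NumberField F] [IsTotallyReal F] [Field E] [NumberField E] [Algebra F E]
  [IsTotallyComplex E] [Algebra.IsQuadraticExtension F E]
variable {P5 : PropC5Data F E} {isotropicAt : ℕ → Prop}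

namespace Sec42Data.HeckeTranslates

variable {C : Sec42Data P5 isotropicAt} (T : C.HeckeTranslates)

/-- **The honest Hecke correspondence on difference points.**  Let `f : N ⟶ K` be levels (`u = X_N → X_K` the transition
morphism, `∇u = C.nablaTr f`, `Alb_u = C.Atr f`), `act : Δ → End(X_N)` a finite family of endomorphisms of `X_N` (the deck
transformations of `u`), `t : A_K → A_N` a homomorphism with `Alb_u ≫ t = ∑_δ Alb(act δ)` (the Albanese trace, ★
`albaneseTraceOfFiniteQuotient_holds`), and `g : I → G`, `s ⊆ I` finite, translates defined at `N → K`.  Then, in the commutative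
group `Hom(∇X_N, A_K)`:
`∇u ≫ α_K ≫ (t ≫ ∑_{i ∈ s} Alb(T_{g_i})) = ∏_δ ∏_{i ∈ s} ∇(act δ) ≫ ∇(T_{g_i}) ≫ α_K` — the honest correspondence
`𝒯 = t ≫ ∑_i Alb(T_{g_i})` takes at the difference point `α_K(∇u z)` the value `∑_{δ,i} α_K(∇(T_{g_i} ∘ act δ) z)`.
[cite: Liu2021, Def. 2.3 (FJcycle.tex l. 1206–1208) and §4.2 (l. 2070–2074)] [cite: Lang1983AbelianVarieties, Ch. VIII §6 Thm. 13 (pp. 224–227)]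
[cite: Milne2005ShimuraVarieties, §5 p. 58] -/
theorem nablaTr_comp_α_comp_trace_sum_albTr {N K : C5.SmallLevel C.S.K₀} (f : N ⟶ K)
    {Δ : Type} [Fintype Δ] (act : Δ → (C.cpt.X.obj N ⟶ C.cpt.X.obj N))
    (t : C.A K ⟶ C.A N) (ht : C.Atr f ≫ t = ∑ δ, (C.alb N).map (C.alb N) (act δ))
    {I : Type} (s : Finset I) (g : I → C.G) (hg : ∀ i, C5.HeckeLE (g i) N K) :
    C.nablaTr f ≫ (C.alb K).α ≫ (t ≫ ∑ i ∈ s, T.albTr (g i) N K (hg i)).hom.hom.hom =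
      ∏ δ, ∏ i ∈ s, (C.alb N).nabla.map (C.alb N).nabla (act δ) ≫
        (C.alb N).nabla.map (C.alb K).nabla (T.tr (g i) N K (hg i)) ≫ (C.alb K).α := by
  -- `∇u ≫ α_K = α_N ≫ Alb_u` (printed identity), and `Alb_u ≫ t = ∑_δ Alb(act δ)`
  have h1 : C.nablaTr f ≫ (C.alb K).α ≫ (t ≫ ∑ i ∈ s, T.albTr (g i) N K (hg i)).hom.hom.hom =
      (C.alb N).α ≫ ((∑ δ, (C.alb N).map (C.alb N) (act δ)) ≫ ∑ i ∈ s, T.albTr (g i) N K (hg i)).hom.hom.hom := by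
    rw [← ht, ← Category.assoc (C.nablaTr f), ← C.α_Atr f, Category.assoc]
    rfl
  rw [h1, Preadditive.sum_comp, comp_finsetSum_hom_hom_hom]
  refine Finset.prod_congr rfl fun δ _ => ?_
  rw [Preadditive.comp_sum, comp_finsetSum_hom_hom_hom]
  refine Finset.prod_congr rfl fun i _ => ?_
  -- `α_N ≫ Alb(act δ) ≫ Alb(T_{g_i}) = ∇(act δ) ≫ ∇(T_{g_i}) ≫ α_K`
  change (C.alb N).α ≫ ((C.alb N).map (C.alb N) (act δ)).hom.hom.hom ≫ (T.albTr (g i) N K (hg i)).hom.hom.hom = _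
  rw [← Category.assoc, Albanese.α_map, Category.assoc, T.α_albTr]

/-- **The honest Hecke correspondence on difference points, `W`-point form**: for every `z : W ⟶ ∇X_N`,
`z ≫ ∇u ≫ α_K ≫ 𝒯 = ∏_δ ∏_{i ∈ s} z ≫ ∇(act δ) ≫ ∇(T_{g_i}) ≫ α_K` in the commutative group `A_K(W)` — on `Ω`-points:
`𝒯(α_K(u x̃, u ỹ)) = ∑_{δ, i} α_K(T_{g_i} δ x̃, T_{g_i} δ ỹ)`. [cite: Liu2021, Def. 2.3 (FJcycle.tex l. 1206–1208) and §4.2 (l. 2070–2074)]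
[cite: Lang1983AbelianVarieties, Ch. VIII §6 Thm. 13 (pp. 224–227)] [cite: Milne2005ShimuraVarieties, §5 p. 58] -/
theorem comp_nablaTr_comp_α_comp_trace_sum_albTr {N K : C5.SmallLevel C.S.K₀} (f : N ⟶ K)
    {Δ : Type} [Fintype Δ] (act : Δ → (C.cpt.X.obj N ⟶ C.cpt.X.obj N))
    (t : C.A K ⟶ C.A N) (ht : C.Atr f ≫ t = ∑ δ, (C.alb N).map (C.alb N) (act δ))
    {I : Type} (s : Finset I) (g : I → C.G) (hg : ∀ i, C5.HeckeLE (g i) N K)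
    {W : SchemeOver E} (z : W ⟶ (C.alb N).nabla.N) :
    z ≫ C.nablaTr f ≫ (C.alb K).α ≫ (t ≫ ∑ i ∈ s, T.albTr (g i) N K (hg i)).hom.hom.hom =
      ∏ δ, ∏ i ∈ s, z ≫ (C.alb N).nabla.map (C.alb N).nabla (act δ) ≫
        (C.alb N).nabla.map (C.alb K).nabla (T.tr (g i) N K (hg i)) ≫ (C.alb K).α := by
  rw [T.nablaTr_comp_α_comp_trace_sum_albTr f act t ht s g hg, comp_finsetProd]
  exact Finset.prod_congr rfl fun δ _ => comp_finsetProd z s _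

end Sec42Data.HeckeTranslates

end Literature.NumberTheory.Automorphic.Liu2021.AppendixC

end
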